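import Mathlib
import Literature.MathematicalPhysics.QuantumFieldTheory.ConstructiveQFTWave0
import Literature.Probability.LatticeModels.LatticeGraph
import Literature.Probability.LatticeModels.SharpnessProofs
import HarnessLib

/-!
# Plaquette neighbours of a link and the sup-distance on the discrete torus

Combinatorics of the torus `(ℤ/L)^d` of Wave 0 (`QuantumFieldTheory.Site/Edge/Plaquette d L`) needed
by Dobrushin's uniqueness technique for plaquette-weight lattice gauge measures on tori
(`PlaquetteWeightTorusDobrushin.lean`): the four edges of a plaquette and the locality of the
plaquette holonomy, the `≤ 2(d-1)` plaquettes through a link, the `≤ 6(d-1)` plaquette-neighbours of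
a link and the joint-plaquette multiplicity `k(x,y)` with `∑_y k(x,y) ≤ 6(d-1)` (Seiler LNP 159 Ch. 2;
Shen–Zhu–Zhu CMP 400 (2023) §2), and the periodic sup-distance `‖·‖_{∞,L}` (coordinatewise
`|valMinAbs|`) with its triangle inequality and comparison with the sup-norm of `ℤ^d` under
`Torus.proj` (Friedli–Velenik 2017 §3.1).

## References
* E. Seiler, LNP 159 (1982), Ch. 2.
* H. Shen, R. Zhu, X. Zhu, CMP 400 (2023) 805–851, §2.
* S. Friedli, Y. Velenik, *Statistical Mechanics of Lattice Systems* (2017), §3.1.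
-/

namespace Literature.MathematicalPhysics.QuantumFieldTheory

open Finset

variable {d L : ℕ}

/-! ### Edges of a torus plaquette; locality of the holonomy -/

/-- The four edges `(x,i), (x+eᵢ,j), (x+eⱼ,i), (x,j)` of the torus plaquette `q = (x, ⟨(i,j), i<j⟩)`
(Chatterjee arXiv:1803.01950 §2; Seiler LNP 159 Ch. 2). [cite: SeilerLNP1982, Ch. 2] -/
def plaqEdgesT (q : Plaquette d L) : Finset (Edge d L) :=
  {(q.1, q.2.1.1), (q.1.shift q.2.1.1, q.2.1.2), (q.1.shift q.2.1.2, q.2.1.1), (q.1, q.2.1.2)}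

/-- The plaquette holonomy reads the configuration only on the four edges of the plaquette.
[cite: SeilerLNP1982, Ch. 2] -/
theorem dependsOn_plaquetteHolonomy {G : Type*} [Group G] (q : Plaquette d L) :
    DependsOn (fun U : GaugeConfig d L G => plaquetteHolonomy U q.1 q.2.1.1 q.2.1.2)
      (↑(plaqEdgesT q) : Set (Edge d L)) := by
  intro U V h
  simp only [plaquetteHolonomy]
  rw [h (q.1, q.2.1.1) (by simp [plaqEdgesT]), h (q.1.shift q.2.1.1, q.2.1.2) (by simp [plaqEdgesT]),
    h (q.1.shift q.2.1.2, q.2.1.1) (by simp [plaqEdgesT]), h (q.1, q.2.1.2) (by simp [plaqEdgesT])]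

/-- A plaquette has at most four edges. [folklore] -/
theorem card_plaqEdgesT_le (q : Plaquette d L) : (plaqEdgesT q).card ≤ 4 := by
  unfold plaqEdgesT
  refine (card_insert_le _ _).trans ?_
  refine (Nat.succ_le_succ (card_insert_le _ _)).trans ?_
  refine (Nat.succ_le_succ (Nat.succ_le_succ (card_insert_le _ _))).trans ?_
  simp

/-! ### Plaquettes through a link, plaquette neighbours, joint multiplicity -/

section Nbr

variable [NeZero L]

/-- The plaquettes of the torus containing the link `e` (`p ≻ e`; at most `2(d-1)` of them).
[cite: SeilerLNP1982, Ch. 2] -/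
def plaqsThrough (e : Edge d L) : Finset (Plaquette d L) :=
  univ.filter fun q => e ∈ plaqEdgesT q

/-- Membership in `plaqsThrough`. [folklore] -/
@[simp] theorem mem_plaqsThrough {e : Edge d L} {q : Plaquette d L} :
    q ∈ plaqsThrough e ↔ e ∈ plaqEdgesT q := by
  simp [plaqsThrough]

/-- The **plaquette neighbours** of the link `x`: the links `≠ x` of the plaquettes through `x` —
the range of the one-link conditional law of a plaquette-weight measure. [cite: SeilerLNP1982, Ch. 2] -/
def linkNbrT (x : Edge d L) : Finset (Edge d L) :=
  ((plaqsThrough x).biUnion plaqEdgesT).erase x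

/-- The **joint-plaquette multiplicity** `k(x,y)`: the number of plaquettes containing both links.
[cite: arXiv220412737, §2] -/
def jointPlaq (x y : Edge d L) : ℕ :=
  ((plaqsThrough x).filter fun q => y ∈ plaqEdgesT q).card

/-- A link is not its own plaquette neighbour. [folklore] -/
theorem not_mem_linkNbrT (x : Edge d L) : x ∉ linkNbrT x := by
  simp [linkNbrT]

/-- Membership in `linkNbrT`. [folklore] -/
theorem mem_linkNbrT_iff {x y : Edge d L} :
    y ∈ linkNbrT x ↔ y ≠ x ∧ ∃ q, x ∈ plaqEdgesT q ∧ y ∈ plaqEdgesT q := by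
  simp [linkNbrT, mem_biUnion]

/-- A link lies on at most `2(d-1)` plaquettes of the torus. [cite: SeilerLNP1982, Ch. 2] -/
theorem card_plaqsThrough_le (e : Edge d L) : (plaqsThrough e).card ≤ 2 * (d - 1) := by
  classical
  -- a plaquette through `e` is recovered from its other direction `j ≠ e.2` and its side
  have hinj : Set.InjOn (fun q : Plaquette d L => (q.1, q.2.1)) ↑(plaqsThrough e) := by
    intro q _ q' _ h
    obtain ⟨h1, h2⟩ := Prod.mk.inj h
    exact Prod.ext h1 (Subtype.ext h2)
  have hsub : (plaqsThrough e).image (fun q : Plaquette d L => (q.1, q.2.1)) ⊆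
      ((univ.erase e.2) ×ˢ (univ : Finset Bool)).image (fun jb : Fin d × Bool =>
        (if jb.2 then e.1 else e.1 - Pi.single jb.1 1, (min e.2 jb.1, max e.2 jb.1))) := by
    intro z hz
    obtain ⟨q, hq, rfl⟩ := mem_image.1 hz
    rw [mem_plaqsThrough] at hq
    have hij : q.2.1.1 < q.2.1.2 := q.2.2
    have hne : q.2.1.1 ≠ q.2.1.2 := hij.ne
    simp only [plaqEdgesT, mem_insert, mem_singleton] at hq
    rw [mem_image]
    rcases hq with rfl | rfl | rfl | rfl
    · exact ⟨(q.2.1.2, true), by simp [hne.symm], by simp [min_eq_left hij.le, max_eq_right hij.le]⟩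
    · exact ⟨(q.2.1.1, false), by simp [hne],
        by simp [Site.shift, min_eq_right hij.le, max_eq_left hij.le]⟩
    · exact ⟨(q.2.1.2, false), by simp [hne.symm],
        by simp [Site.shift, min_eq_left hij.le, max_eq_right hij.le]⟩
    · exact ⟨(q.2.1.1, true), by simp [hne], by simp [min_eq_right hij.le, max_eq_left hij.le]⟩
  calc (plaqsThrough e).card
      = ((plaqsThrough e).image (fun q : Plaquette d L => (q.1, q.2.1))).card :=
        (card_image_of_injOn hinj).symm
    _ ≤ (((univ.erase e.2) ×ˢ (univ : Finset Bool)).image (fun jb : Fin d × Bool =>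
          (if jb.2 then e.1 else e.1 - Pi.single jb.1 1, (min e.2 jb.1, max e.2 jb.1)))).card :=
        card_le_card hsub
    _ ≤ ((univ.erase e.2) ×ˢ (univ : Finset Bool)).card := card_image_le
    _ = 2 * (d - 1) := by
        rw [card_product, card_erase_of_mem (mem_univ _), card_univ, Fintype.card_fin, card_univ,
          Fintype.card_bool]
        ring

/-- A link has at most `6(d-1)` plaquette neighbours. [cite: arXiv220412737, §2] -/
theorem card_linkNbrT_le (x : Edge d L) : (linkNbrT x).card ≤ 6 * (d - 1) := by
  classical
  have hsub : linkNbrT x ⊆ (plaqsThrough x).biUnion fun q => (plaqEdgesT q).erase x := by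
    intro y hy
    obtain ⟨hyx, hy⟩ := mem_erase.1 hy
    obtain ⟨q, hq, hyq⟩ := mem_biUnion.1 hy
    exact mem_biUnion.2 ⟨q, hq, mem_erase.2 ⟨hyx, hyq⟩⟩
  have hthree : ∀ q ∈ plaqsThrough x, ((plaqEdgesT q).erase x).card ≤ 3 := fun q hq => by
    rw [card_erase_of_mem (mem_plaqsThrough.1 hq)]
    have := card_plaqEdgesT_le q
    omega
  calc (linkNbrT x).card
      ≤ ((plaqsThrough x).biUnion fun q => (plaqEdgesT q).erase x).card := card_le_card hsub
    _ ≤ ∑ q ∈ plaqsThrough x, ((plaqEdgesT q).erase x).card := card_biUnion_le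
    _ ≤ ∑ _q ∈ plaqsThrough x, 3 := sum_le_sum hthree
    _ = 3 * (plaqsThrough x).card := by rw [sum_const, smul_eq_mul, mul_comm]
    _ ≤ 3 * (2 * (d - 1)) := Nat.mul_le_mul_left 3 (card_plaqsThrough_le x)
    _ = 6 * (d - 1) := by ring

/-- `k(x,y) ≤ 2(d-1)`. [folklore] -/
theorem jointPlaq_le (x y : Edge d L) : jointPlaq x y ≤ 2 * (d - 1) :=
  (card_filter_le _ _).trans (card_plaqsThrough_le x)

/-- **Double counting**: `∑_{y ∈ nbr x} k(x,y) ≤ 6(d-1)` (each of the `≤ 2(d-1)` plaquettes through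
`x` has `≤ 3` other links). [cite: arXiv220412737, §2] -/
theorem sum_jointPlaq_le (x : Edge d L) :
    ∑ y ∈ linkNbrT x, (jointPlaq x y : ℝ) ≤ 6 * (d - 1 : ℕ) := by
  classical
  have hthree : ∀ q ∈ plaqsThrough x,
      ((linkNbrT x).filter fun y => y ∈ plaqEdgesT q).card ≤ 3 := fun q hq => by
    have hsub : ((linkNbrT x).filter fun y => y ∈ plaqEdgesT q) ⊆ (plaqEdgesT q).erase x := by
      intro y hy
      obtain ⟨hy1, hy2⟩ := mem_filter.1 hy
      exact mem_erase.2 ⟨(mem_linkNbrT_iff.1 hy1).1, hy2⟩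
    refine (card_le_card hsub).trans ?_
    rw [card_erase_of_mem (mem_plaqsThrough.1 hq)]
    have := card_plaqEdgesT_le q
    omega
  have hnat : ∑ y ∈ linkNbrT x, jointPlaq x y ≤ 6 * (d - 1) := by
    calc ∑ y ∈ linkNbrT x, jointPlaq x y
        = ∑ y ∈ linkNbrT x, ∑ q ∈ plaqsThrough x, if y ∈ plaqEdgesT q then 1 else 0 := by
          refine sum_congr rfl fun y _ => ?_
          rw [jointPlaq, card_eq_sum_ones, sum_filter]
      _ = ∑ q ∈ plaqsThrough x, ∑ y ∈ linkNbrT x, if y ∈ plaqEdgesT q then 1 else 0 := sum_comm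
      _ = ∑ q ∈ plaqsThrough x, ((linkNbrT x).filter fun y => y ∈ plaqEdgesT q).card := by
          refine sum_congr rfl fun q _ => ?_
          rw [card_eq_sum_ones, sum_filter]
      _ ≤ ∑ _q ∈ plaqsThrough x, 3 := sum_le_sum hthree
      _ = 3 * (plaqsThrough x).card := by rw [sum_const, smul_eq_mul, mul_comm]
      _ ≤ 3 * (2 * (d - 1)) := Nat.mul_le_mul_left 3 (card_plaqsThrough_le x)
      _ = 6 * (d - 1) := by ring
  exact_mod_cast hnat

end Nbr

/-! ### The periodic sup-distance -/

/-- The periodic sup-norm `‖x‖_{∞,L} = maxᵢ |valMinAbs (x i)|` of a torus site (the graph distance to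
`0` in the sup-metric of `(ℤ/L)^d`). [cite: FriedliVelenik2017, §3.1] -/
def torusNorm (x : Site d L) : ℕ := univ.sup fun i => ((x i).valMinAbs).natAbs

/-- Coordinates are bounded by the periodic sup-norm. [folklore] -/
theorem natAbs_valMinAbs_le_torusNorm (x : Site d L) (i : Fin d) :
    ((x i).valMinAbs).natAbs ≤ torusNorm x :=
  le_sup (f := fun i => ((x i).valMinAbs).natAbs) (mem_univ i)

/-- `‖0‖_{∞,L} = 0`. [folklore] -/
@[simp] theorem torusNorm_zero : torusNorm (0 : Site d L) = 0 := by
  simp [torusNorm]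

/-- `‖-x‖_{∞,L} = ‖x‖_{∞,L}`. [folklore] -/
theorem torusNorm_neg (x : Site d L) : torusNorm (-x) = torusNorm x := by
  simp [torusNorm, ZMod.natAbs_valMinAbs_neg]

/-- Triangle inequality for the periodic sup-norm. [folklore] -/
theorem torusNorm_add_le (x y : Site d L) : torusNorm (x + y) ≤ torusNorm x + torusNorm y := by
  refine Finset.sup_le fun i _ => ?_
  calc ((x + y) i).valMinAbs.natAbs = ((x i + y i).valMinAbs).natAbs := rfl
    _ ≤ ((x i).valMinAbs + (y i).valMinAbs).natAbs := ZMod.natAbs_valMinAbs_add_le _ _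
    _ ≤ (x i).valMinAbs.natAbs + (y i).valMinAbs.natAbs := Int.natAbs_add_le _ _
    _ ≤ torusNorm x + torusNorm y :=
        add_le_add (natAbs_valMinAbs_le_torusNorm x i) (natAbs_valMinAbs_le_torusNorm y i)

/-- `‖x - z‖ ≤ ‖x - y‖ + ‖y - z‖`. [folklore] -/
theorem torusNorm_sub_le (x y z : Site d L) :
    torusNorm (x - z) ≤ torusNorm (x - y) + torusNorm (y - z) := by
  have h := torusNorm_add_le (x - y) (y - z)
  rwa [sub_add_sub_cancel] at h

/-- `|valMinAbs (m : ZMod L)| ≤ |m|`: the centred representative is the smallest one. [folklore] -/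
theorem natAbs_valMinAbs_intCast_le (L : ℕ) (m : ℤ) :
    ((m : ZMod L).valMinAbs).natAbs ≤ m.natAbs := by
  rcases Nat.eq_zero_or_pos L with rfl | hL
  · exact (congrArg Int.natAbs (Int.cast_id (n := m))).le
  · haveI : NeZero L := ⟨hL.ne'⟩
    exact ZMod.natAbs_min_of_le_div_two L _ _ (ZMod.coe_valMinAbs _) (ZMod.natAbs_valMinAbs_le _)

/-- The projection `ℤ^d → (ℤ/L)^d` does not increase the sup-norm. [folklore] -/
theorem torusNorm_proj_le (z : Literature.Probability.LatticeModels.Site d) :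
    torusNorm (Literature.Probability.LatticeModels.Torus.proj L z) ≤
      Literature.Probability.LatticeModels.Site.supNorm z := by
  refine Finset.sup_le fun i _ => ?_
  exact (natAbs_valMinAbs_intCast_le L (z i)).trans
    (Literature.Probability.LatticeModels.Site.natAbs_le_supNorm z i)

/-- Below half the period the projection preserves the sup-norm. [folklore] -/
theorem torusNorm_proj_eq {z : Literature.Probability.LatticeModels.Site d}
    (hz : 2 * Literature.Probability.LatticeModels.Site.supNorm z < L) :
    torusNorm (Literature.Probability.LatticeModels.Torus.proj L z) =
      Literature.Probability.LatticeModels.Site.supNorm z := by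
  haveI : NeZero L := ⟨by omega⟩
  unfold torusNorm Literature.Probability.LatticeModels.Site.supNorm
  refine Finset.sup_congr rfl fun i _ => ?_
  refine le_antisymm (natAbs_valMinAbs_intCast_le L (z i)) ?_
  refine ZMod.natAbs_min_of_le_div_two L (z i) _ (ZMod.coe_valMinAbs _).symm ?_
  have := Literature.Probability.LatticeModels.Site.natAbs_le_supNorm z i
  omega

/-- Coordinates of the base point of an edge of `q` exceed those of `q.1` by `0` or `1`. [folklore] -/
theorem apply_sub_eq_zero_or_one_of_mem_plaqEdgesT {q : Plaquette d L} {e : Edge d L}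
    (he : e ∈ plaqEdgesT q) (k : Fin d) : e.1 k - q.1 k = 0 ∨ e.1 k - q.1 k = 1 := by
  simp only [plaqEdgesT, mem_insert, mem_singleton] at he
  rcases he with rfl | rfl | rfl | rfl
  · exact Or.inl (by simp)
  · by_cases hk : k = q.2.1.1
    · subst hk; exact Or.inr (by simp [Site.shift])
    · exact Or.inl (by simp [Site.shift, hk])
  · by_cases hk : k = q.2.1.2
    · subst hk; exact Or.inr (by simp [Site.shift])
    · exact Or.inl (by simp [Site.shift, hk])
  · exact Or.inl (by simp)

/-- `|valMinAbs 1| ≤ 1` in `ZMod L`. [folklore] -/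
theorem natAbs_valMinAbs_one_le_one : ((1 : ZMod L).valMinAbs).natAbs ≤ 1 := by
  have h := natAbs_valMinAbs_intCast_le L 1
  rwa [Int.cast_one] at h

/-- Base points of two links on a common plaquette are at periodic sup-distance `≤ 1`. [folklore] -/
theorem torusNorm_sub_le_one_of_mem_plaqEdgesT {q : Plaquette d L} {x y : Edge d L}
    (hx : x ∈ plaqEdgesT q) (hy : y ∈ plaqEdgesT q) : torusNorm (x.1 - y.1) ≤ 1 := by
  refine Finset.sup_le fun k _ => ?_
  have h1 := apply_sub_eq_zero_or_one_of_mem_plaqEdgesT hx k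
  have h2 := apply_sub_eq_zero_or_one_of_mem_plaqEdgesT hy k
  have h0 : ((0 : ZMod L).valMinAbs).natAbs ≤ 1 := by simp
  have hn : ((-1 : ZMod L).valMinAbs).natAbs ≤ 1 := by
    rw [ZMod.natAbs_valMinAbs_neg]; exact natAbs_valMinAbs_one_le_one
  show ((x.1 - y.1) k).valMinAbs.natAbs ≤ 1
  rw [Pi.sub_apply, ← sub_sub_sub_cancel_right (x.1 k) (y.1 k) (q.1 k)]
  rcases h1 with h1 | h1 <;> rcases h2 with h2 | h2 <;> rw [h1, h2]
  · rwa [sub_zero]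
  · rwa [zero_sub]
  · rw [sub_zero]; exact natAbs_valMinAbs_one_le_one
  · rwa [sub_self]

/-- Base points of plaquette neighbours are at periodic sup-distance `≤ 1`. [folklore] -/
theorem torusNorm_sub_le_one_of_mem_linkNbrT [NeZero L] {x y : Edge d L} (hy : y ∈ linkNbrT x) :
    torusNorm (x.1 - y.1) ≤ 1 := by
  obtain ⟨-, q, hx, hy⟩ := mem_linkNbrT_iff.1 hy
  exact torusNorm_sub_le_one_of_mem_plaqEdgesT hx hy

end Literature.MathematicalPhysics.QuantumFieldTheory
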